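import Literature.MathematicalPhysics.QuantumFieldTheory.Federbush1986.PlaquetteGramMatrix
import Literature.MathematicalPhysics.QuantumFieldTheory.Federbush1986.ModeAnalyticityGaugeRepair

/-!
# `Federbush1986.LandauModeMultipliers` — [Federbush1986PhaseCellI] p. 327 «We seek a minimum of the action S, for a Landau
# gauge A′ … S = ½∫Σ(∂A′_i/∂x_j)² + ½α²Σ_{p∈ℒ⁰}((χ_p, A′) − β_p)², (3.4) and then take the limit α → ∞. (Alternatively one could
# use Lagrange multipliers.)» — THE LAGRANGE MULTIPLIERS OF THE MODE IN MOMENTUM SPACE: the Landau condition `p·A′(p) = 0`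
# (`Σ_i l_i = 0`), the bond test function `b̂_μ` with `P̃_a` its lattice curl, **`p²A′_μ(p) = Λ_μ(p) b̂_μ(p)` with `Λ_μ`
# `2π`-PERIODIC, a lattice co-boundary, and BOUNDED on the real momenta** — PROVED ([FederbushWilliamson1987PhaseCellII] (2.1)–(2.3))

statement-level skeleton of published theorems with citation tags; proofs where landed; nothing here is a claim about the Yang–Mills mass gap

CITATION HEADER.  P. Federbush, *A phase cell approach to Yang–Mills theory. I. Modes, lattice-continuum duality*, Commun.
Math. Phys. **107** (1986) 319–329 [Federbush1986PhaseCellI] (p. 327–328 READ AS IMAGES `run/shared/lean/pub/lit-balaban/lit-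
balaban-r17/renders/fedI/fed1986-cmp107-p009|p010-x2.png`); P. Federbush, C. Williamson, *… II. Analysis of a mode*, J. Math.
Phys. **28** (1987) 1416–1419 [FederbushWilliamson1987PhaseCellII] (p. 1416–1417 READ AS IMAGES `…/b2b-balaban-t4-lit2/g7/
fw1987II/fedwill1987-jmp28-II-p001|p002-x2.png`).  Unit `lit-balaban-r17` gen 11 (fold owner of the Federbush block; own lane
`Federbush1986/`), SKELETON rows **F1.Eq3.2-3.12** (cells (3.4), (3.11): the multiplier structure of the constrained minimiser)
and **F2.Eq2.1-2.5** ((2.1)–(2.3)); heads unchanged.  HOME `run/shared/lean/pub/lit-balaban/`.  Builds on `PlaquetteGramMatrix`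
(r17 gen 11: `fourierFactor_eq`, `rL0`, the real brackets `invSqBracketR`, (3.1) periodicity `bracket_shift`).  First file of
the lane's remaining target, the third clause of §3 p. 327 «minimizing the continuum action subject to this constraint» for
the explicit field of `CorrectedModePlaquetteVariables` (its hypothesis `hmin`): the weak Euler–Lagrange structure of the mode.

THE PRINT (verbatim).  I p. 327: *«We seek a minimum of the action S, for a Landau gauge A′, a gauge transformation of A.
S = ½∫Σ_{i,j}(∂A′_i/∂x_j)² + ½α² Σ_{p∈ℒ⁰}((χ_p, A′) − β_p)², (3.4) and then take the limit α → ∞. (Alternatively one could use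
Lagrange multipliers.)»*; p. 328: *«From (3.4) we see the minimizing A′ will satisfy A′ = α²C Σ_γ β_γχ_γ. (3.11)»*; p. 325:
*«We associate to this bond (with an orientation in the + x_i direction) the group element 2^{3r} ∫dx_t ∫dx_s ∫dx ∫dy c(x)A_i(·), (2.1)
where c(x) = 2^r(x − x_i) for (x − x_i) ≦ 2^{−r}, 2 − 2^r(x − x_i) for (x − x_i) ≧ 2^{−r}. (2.2)»* (v1.1 DOCFIX, r17 gen 13 quotation
audit; declarations untouched: the v1 rendering «A(e_i) … the average over base points in the unit cube … with the weighting …» paraphrased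
the sentence around (2.1)–(2.2)).  II p. 1417: *«A′_i = (−r_L f̄₁⁻¹ (1/p²))(1/p_i)(16/𝒟) l_i, (2.1) l₁ =
⟨1/p₂²⟩⟨1/p₃²⟩ + ⟨1/p₂²⟩⟨1/p₄²⟩ + ⟨1/p₃²⟩⟨1/p₄²⟩, (2.2) l_i = −∏_{j≠1,i}⟨1/p_j²⟩, i ≠ 1. (2.3)»*; p. 1416–1417: *«r_L ≡ −(i/(2π)²)
∏_k((e^{−ip_k} − 1)/p_k), (1.7) … 𝒟 = 16Σ_k∏_{j≠k}⟨1/p_j²⟩. (1.18) … f_i, D, 𝒟, and ⟨·⟩ are periodic functions of p,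
invariant under p → p + 2πn (3.1)»*.

WHY (the argument this file serves; the analysis is the sequel's).  The continuum action of a competitor `A^N + ψ` with the same
level-0 plaquette variables exceeds that of `A^N` by `‖F(ψ)‖² + 2⟨F(A^N), F(ψ)⟩`; the cross term is, in momentum space,
`Re ∫ p²Â′(p)·ψ̌(−p) d⁴p` (the gauge parts drop, `p·Â′ = 0`).  With `p²Â′_μ = Λ_μ b̂_μ` and `Λ` periodic AND BOUNDED, the cell
decomposition turns it into `Σ_μ ∫_cell Λ_μ(p) U_μ(p)`, `U_μ` = the periodisation of `b̂_μψ̌_μ` (the Fourier series of the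
bond pairings of `ψ`); since `Λ_μ = Σ_a w_μ(a) f_{ā(μ)} x_a` is a lattice co-boundary, `Σ_μ Λ_μU_μ = Σ_a x_a H_a` pointwise with
`H_a` the periodisation of the PLAQUETTE pairings' transform, which vanishes when `(χ_q, ψ) = 0` for all `q ∈ ℒ⁰` (Poisson
summation) — the multiplier mechanism of (3.4)/(3.11).  Boundedness of `Λ` (§5) is what makes every exchange absolutely
convergent although the plaquette multipliers `x_a` themselves are unbounded near the lattice hyperplanes.

WHAT IS PROVED (kernel-checked; `def`s with bodies; no `Prop`-valued definition, no named fact).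
* §1 **`sum_l : Σ_i l_i = 0`** ((2.3) unfolded by p04's `ModeAnalyticityGaugeRepair.l_one/l_two/l_three`), **`sum_coord_mul_Aprime : Σ_i p_iA′_i(p) = 0`**
  (the Landau gauge of (2.1), all `p_i ≠ 0`).
* §2 `bondFactor μ p` — the convention-free transform shape of the level-0 bond test function (tent × three unit intervals;
  its identification with `∫e^{−ip·z}·bondWeight` is left to the sequel, cf. `fourier_plaqTestField_level0` for plaquettes),
  `bondFactor_eq : b̂_μ = −rL0·f_μ/p_μ`, **`fourierFactor_eq_bondFactor`: `P̃_{(i,j),i} = −f_j b̂_i`, `P̃_{(i,j),j} = f_i b̂_j`**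
  (the plaquette test function is the lattice curl of the bond test functions, (1.13)–(1.14), in momentum space).
* §3 `Lam μ p := (1/2π)² f̄₁⁻¹ f_μ⁻¹ (16/𝒟) l_μ`; periodicity `invSqBracket_shift`, `l_shift`, `scrD_shift`, **`Lam_shift`**;
  **`csq_mul_Aprime_eq : p²A′_μ(p) = Λ_μ(p)·b̂_μ(p)`** at every real `p` off `2πℤ⁴`.
* §4 `partnerF`, `xLam`, `sum_Lam_mul_f` (`Σ_μ Λ_μf_μ = 0`), **`Lam_eq_sum_xLam : Λ_μ = Σ_a w_μ(a) f_{ā(μ)} x_a`** (explicit `x`).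
* §5 `norm_sq_f_toC` (`|f_k|² = 2 − 2cos p_k`), `norm_fbar_toC`, **`c0_le_invSqBracketR_mul : ⟨1/p_k²⟩|f_k|² ≥ c₀ := (1/4π²)(4/π²)⁵`**
  (nearest lattice term + Jordan's inequality), `scrD_toC_re`, and **`norm_Lam_toC_le : |Λ_μ(p)| ≤ (1/2π)²/c₀`** at every real `p`
  off `2πℤ⁴` (from `16|l_μ| ≤ 𝒟·min(1/⟨1/p₁²⟩, 1/⟨1/p_μ²⟩)`).

HONEST SCOPE.  (a) Print leaves the α → ∞ limit of (3.4) and the phrase «Lagrange multipliers» undeveloped; `Λ_μ`, `x_a` and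
the identities here are this file's explicit rendering of that structure for the EXPLICIT mode (2.1) — algebra on print's
formulas, each step citing the display it unfolds; nothing is attributed to print beyond the displays quoted.  (b) Real momenta
off `2πℤ⁴` for the identity and the bound (where (2.1) is defined; a null set); `Lam`, `xLam` are typed on `ℂ⁴` like the F-II
vocabulary.  (c) Nothing here about the continuum action, competitors, Fourier inversion or Poisson summation — the sequel.
(d) `bondFactor` is a closed form; that it IS the transform of the tree's `bondWeight` is not proved here.  Axioms standard.
-/

namespace Literature.MathematicalPhysics.QuantumFieldTheory.Federbush1986

noncomputable section

open Complex ModeAnalyticity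
open scoped BigOperators ComplexConjugate

namespace PlaquetteGram

open ModeDecay (toC)

/-! ## §1 The Landau gauge: `Σ_i l_i = 0`, `p·A′(p) = 0` -/

/-- **`Σ_i l_i = 0`** — (2.2) is minus the sum of (2.3): the algebraic form of the Landau gauge of `A′`.
[cite: FederbushWilliamson1987PhaseCellII, (2.2)–(2.3) p. 1417; Federbush1986PhaseCellI, p. 327 «a Landau gauge A′»] -/
theorem sum_l (p : Momentum) : ∑ i, l i p = 0 := by
  rw [Fin.sum_univ_four, ModeAnalyticityBracketSplit.l_zero, ModeAnalyticityGaugeRepair.l_one,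
    ModeAnalyticityGaugeRepair.l_two, ModeAnalyticityGaugeRepair.l_three]
  ring

/-- **The Landau gauge condition `p·A′(p) = Σ_i p_iA′_i(p) = 0`** (at every momentum with all `p_i ≠ 0`, where (2.1) is
defined). [cite: Federbush1986PhaseCellI, p. 327 «We seek a minimum of the action S, for a Landau gauge A′»;
FederbushWilliamson1987PhaseCellII, (2.1)–(2.3) p. 1417] -/
theorem sum_coord_mul_Aprime {p : Momentum} (hp : ∀ i, p i ≠ 0) : ∑ i, p i * Aprime i p = 0 := by
  have h : ∀ i, p i * Aprime i p = (-rL p * (fbar p 0)⁻¹ * (1 / csq p)) * (16 / scrD p) * l i p := by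
    intro i
    unfold Aprime
    field_simp [hp i]
  simp_rw [h, ← Finset.mul_sum, sum_l, mul_zero]

/-! ## §2 The bond test function in momentum space: `b̂_μ`, and `P̃_a` as a lattice curl of `b̂` -/

/-- **The (convention-free) Fourier transform shape of the level-0 BOND test function** in direction `μ` at the origin — the
tent `c` (2.2) in `x_μ` (`∫_0^2 c(y)e^{−ipy}dy = −(1 − e^{−ip})²/p²`) times unit intervals in the three transverse directions
(`∫_0^1 e^{−ipy}dy = (i/p)(e^{−ip} − 1)`); cf. `fourierFactor` for plaquettes.  (Identified with `∫ e^{−ip·z}·bondWeight` in the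
sequel; here it is the closed form.) [cite: Federbush1986PhaseCellI, (2.1)–(2.2) p. 325, (3.10) p. 328] -/
def bondFactor (μ : Fin 4) (p : Fin 4 → ℝ) : ℂ :=
  (∏ k ∈ Finset.univ.erase μ, I * (cexp (-I * p k) - 1) / p k) * (-(1 - cexp (-I * p μ)) ^ 2 / (p μ : ℂ) ^ 2)

/-- `b̂_μ = −rL0·f_μ/p_μ` (`rL0 = (2π)²r_L` of (1.7)). [cite: FederbushWilliamson1987PhaseCellII, (1.7) p. 1416; Federbush1986PhaseCellI, (2.2) p. 325] -/
theorem bondFactor_eq (μ : Fin 4) (p : Fin 4 → ℝ) :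
    bondFactor μ p = -(rL0 (toC p) * f (toC p) μ / (p μ : ℂ)) := by
  unfold bondFactor rL0
  rw [← Finset.mul_prod_erase Finset.univ (fun k => f (toC p) k / toC p k) (Finset.mem_univ μ)]
  have hcard : (Finset.univ.erase μ).card = 3 := by
    rw [Finset.card_erase_of_mem (Finset.mem_univ μ)]; simp
  have hprod : ∏ k ∈ Finset.univ.erase μ, I * (cexp (-I * p k) - 1) / p k
      = I ^ 3 * ∏ k ∈ Finset.univ.erase μ, f (toC p) k / toC p k := by
    calc ∏ k ∈ Finset.univ.erase μ, I * (cexp (-I * p k) - 1) / p k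
        = ∏ k ∈ Finset.univ.erase μ, I * (f (toC p) k / toC p k) :=
          Finset.prod_congr rfl fun k _ => by simp only [f, toC_apply]; ring
      _ = (∏ _k ∈ Finset.univ.erase μ, I) * ∏ k ∈ Finset.univ.erase μ, f (toC p) k / toC p k :=
          Finset.prod_mul_distrib
      _ = _ := by rw [Finset.prod_const, hcard]
  rw [hprod]
  have hI3 : I ^ 3 = -I := by rw [pow_succ, I_sq]; ring
  rw [hI3]
  simp only [f, toC_apply]
  ring

/-- **`P̃_a` is the lattice curl of `b̂`**: for the pair `a = (i, j)`, `P̃_{a,i} = −f_j b̂_i`, `P̃_{a,j} = f_i b̂_j`, other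
components `0` — the momentum form of `χ_p = b_{(y,i)} + b_{(y+e_i,j)} − b_{(y+e_j,i)} − b_{(y,j)}` ((1.13)/(1.14): the
plaquette test function is the signed sum of the four bond test functions). [cite: Federbush1986PhaseCellI, (1.13)–(1.14) p. 324,
(3.10) p. 328; FederbushWilliamson1987PhaseCellII, (1.8)–(1.9) p. 1416] -/
theorem fourierFactor_eq_bondFactor (a : Fin 6) (p : Fin 4 → ℝ) (μ : Fin 4) :
    fourierFactor (axisPair a).1 (axisPair a).2 p μ
      = (if μ = (axisPair a).1 then -(f (toC p) (axisPair a).2 * bondFactor (axisPair a).1 p) else 0)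
        + (if μ = (axisPair a).2 then f (toC p) (axisPair a).1 * bondFactor (axisPair a).2 p else 0) := by
  have hne : (axisPair a).1 ≠ (axisPair a).2 := by fin_cases a <;> decide
  rw [fourierFactor_eq]
  by_cases h1 : μ = (axisPair a).1
  · have h2 : μ ≠ (axisPair a).2 := fun h => hne (h1.symm.trans h)
    rw [if_pos h1, if_neg h2, add_zero, w, if_pos h1.symm, bondFactor_eq, dMat, Matrix.diagonal_apply_eq, ← h1]
    ring
  · by_cases h2 : μ = (axisPair a).2
    · rw [if_neg h1, if_pos h2, zero_add, w, if_neg (Ne.symm h1), if_pos h2.symm, bondFactor_eq, dMat,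
        Matrix.diagonal_apply_eq, ← h2]
      ring
    · rw [if_neg h1, if_neg h2, add_zero, w, if_neg (Ne.symm h1), if_neg (Ne.symm h2)]
      simp

/-! ## §3 The multipliers `Λ_μ`: `p²A′_μ(p) = Λ_μ(p) b̂_μ(p)` with `Λ_μ` periodic -/

/-- **The momentum-space Lagrange multipliers of the constrained minimisation (3.4) (α → ∞), in bond form**:
`Λ_μ(p) := (1/2π)² f̄₁⁻¹ f_μ⁻¹ (16/𝒟) l_μ` — the periodic function with `p²A′_μ = Λ_μ b̂_μ` (`csq_mul_Aprime_eq`), i.e.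
`−ΔA′ = Σ_bonds λ_e b_e` with `λ` the Fourier coefficients of `Λ`. [cite: Federbush1986PhaseCellI, (3.4) p. 327, (3.11)–(3.12) p. 328;
FederbushWilliamson1987PhaseCellII, (2.1) p. 1417] -/
def Lam (μ : Fin 4) (p : Momentum) : ℂ :=
  (1 / (2 * Real.pi) ^ 2 : ℂ) * (fbar p 0)⁻¹ * (f p μ)⁻¹ * (16 / scrD p) * l μ p

/-- `⟨1/p_j²⟩` is `2π`-periodic (II (3.1)). [cite: FederbushWilliamson1987PhaseCellII, (3.1) p. 1417] -/
@[simp] theorem invSqBracket_shift (j : Fin 4) (p : Momentum) (n : Fin 4 → ℤ) :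
    invSqBracket j (shift p n) = invSqBracket j p :=
  bracket_shift _ p n

/-- `l_i` is `2π`-periodic. [cite: FederbushWilliamson1987PhaseCellII, (3.1) p. 1417, (2.2)–(2.3) p. 1417] -/
@[simp] theorem l_shift (i : Fin 4) (p : Momentum) (n : Fin 4 → ℤ) : l i (shift p n) = l i p := by
  simp [l]

/-- `𝒟` is `2π`-periodic («f_i, D, 𝒟, and ⟨·⟩ are periodic»). [cite: FederbushWilliamson1987PhaseCellII, (3.1) p. 1417] -/
@[simp] theorem scrD_shift (p : Momentum) (n : Fin 4 → ℤ) : scrD (shift p n) = scrD p := by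
  simp [scrD]

/-- **`Λ_μ` is `2π`-periodic.** [cite: FederbushWilliamson1987PhaseCellII, (3.1) p. 1417] -/
@[simp] theorem Lam_shift (μ : Fin 4) (p : Momentum) (n : Fin 4 → ℤ) : Lam μ (shift p n) = Lam μ p := by
  simp [Lam]

/-- [folklore] -/
private theorem csq_toC_sumSq (p : Fin 4 → ℝ) :
    csq (toC p) = ((∑ j, p j ^ 2 : ℝ) : ℂ) :=
  ModeAnalyticityThm31Refutation.csq_ofReal p

/-- `p² ≠ 0` at a non-zero real momentum. [cite: FederbushWilliamson1987PhaseCellII, (1.4) p. 1416] -/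
theorem csq_toC_ne_zero' {p : Fin 4 → ℝ} {k : Fin 4} (hk : p k ≠ 0) : csq (toC p) ≠ 0 := by
  rw [csq_toC_sumSq p]
  have : 0 < ∑ j, p j ^ 2 := lt_of_lt_of_le (by positivity) (Finset.single_le_sum (f := fun j => p j ^ 2)
    (fun j _ => sq_nonneg (p j)) (Finset.mem_univ k))
  exact_mod_cast this.ne'

/-- **`p² A′_μ(p) = Λ_μ(p) b̂_μ(p)`** at every real momentum with no component in `2πℤ`: (2.1) rewritten with `r_L(1/p_μ) =
−(1/2π)² b̂_μ/f_μ`. [cite: FederbushWilliamson1987PhaseCellII, (2.1) p. 1417, (1.7) p. 1416; Federbush1986PhaseCellI, (3.12) p. 328] -/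
theorem csq_mul_Aprime_eq {p : Fin 4 → ℝ} (hp : ∀ k (m : ℤ), p k ≠ 2 * Real.pi * m) (μ : Fin 4) :
    csq (toC p) * Aprime μ (toC p) = Lam μ (toC p) * bondFactor μ p := by
  have hp0 : ∀ k, p k ≠ 0 := fun k h => hp k 0 (by simpa using h)
  have hf : f (toC p) μ ≠ 0 := f_toC_ne_zero (hp μ)
  have hpμ : (p μ : ℂ) ≠ 0 := ofReal_ne_zero.mpr (hp0 μ)
  have hc : csq (toC p) ≠ 0 := csq_toC_ne_zero' (hp0 μ)
  have hπ : (2 * Real.pi : ℂ) ^ 2 ≠ 0 := pow_ne_zero _ (mul_ne_zero two_ne_zero (ofReal_ne_zero.mpr Real.pi_ne_zero))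
  rw [bondFactor_eq, rL0_eq]
  unfold Aprime Lam
  simp only [toC_apply]
  field_simp

/-! ## §4 `Λ` is a lattice co-boundary: `Λ_μ = Σ_{a ∋ μ} w_μ(a) f_{ā(μ)} x_a` -/

/-- For a pair `a = (i, j)` and `μ ∈ {i, j}`, the factor `f` of the OTHER axis of the pair. [cite: FederbushWilliamson1987PhaseCellII, (1.3) p. 1416] -/
def partnerF (a : Fin 6) (μ : Fin 4) (p : Momentum) : ℂ :=
  if μ = (axisPair a).1 then f p (axisPair a).2 else f p (axisPair a).1

/-- An explicit plaquette-indexed vector `x` with `Λ_μ = Σ_a w_μ(a) f_{ā(μ)} x_a` (supported on the three pairs containing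
the first axis). [cite: FederbushWilliamson1987PhaseCellII, (1.1), (1.3) p. 1416] -/
def xLam (p : Momentum) : Fin 6 → ℂ :=
  ![-(Lam 1 p / f p 0), 0, 0, -(Lam 2 p / f p 0), -(Lam 3 p / f p 0), 0]

/-- `Σ_μ Λ_μ f_μ = 0` (from `Σ l_μ = 0`). [cite: FederbushWilliamson1987PhaseCellII, (2.2)–(2.3) p. 1417] -/
theorem sum_Lam_mul_f {p : Momentum} (hf : ∀ μ, f p μ ≠ 0) : ∑ μ, Lam μ p * f p μ = 0 := by
  have h : ∀ μ, Lam μ p * f p μ = (1 / (2 * Real.pi) ^ 2 : ℂ) * (fbar p 0)⁻¹ * (16 / scrD p) * l μ p := by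
    intro μ; unfold Lam; field_simp [hf μ]
  simp_rw [h, ← Finset.mul_sum, sum_l, mul_zero]

/-- [folklore] -/
private theorem fin4_cases (μ : Fin 4) : μ = 0 ∨ μ = 1 ∨ μ = 2 ∨ μ = 3 := by
  fin_cases μ <;> simp

/-- **`Λ` is a lattice co-boundary in momentum space**: `Λ_μ(p) = Σ_a w_μ(a) f_{ā(μ)}(p) x_a(p)` for the explicit `x = xLam p`
(all `f_μ(p) ≠ 0`) — the bond multipliers come from plaquette multipliers (`λ_e = Σ_{p ∋ e} ±λ_p`), as they must for a
constraint on PLAQUETTE variables. [cite: Federbush1986PhaseCellI, (3.4) p. 327, (3.11) p. 328; FederbushWilliamson1987PhaseCellII, (1.1), (1.3) p. 1416] -/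
theorem Lam_eq_sum_xLam {p : Momentum} (hf : ∀ μ, f p μ ≠ 0) (μ : Fin 4) :
    Lam μ p = ∑ a, w μ a * partnerF a μ p * xLam p a := by
  have h0 := sum_Lam_mul_f hf
  rw [Fin.sum_univ_four] at h0
  have hf0 := hf 0
  rcases fin4_cases μ with rfl | rfl | rfl | rfl
  · have e : Lam 0 p = -(Lam 1 p * f p 1 + Lam 2 p * f p 2 + Lam 3 p * f p 3) / f p 0 := by
      rw [eq_div_iff hf0]; linear_combination h0
    simp [Fin.sum_univ_succ, w, partnerF, xLam, axisPair]
    rw [e]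
    ring
  · simp [Fin.sum_univ_succ, w, partnerF, xLam, axisPair]
    field_simp
  · simp [Fin.sum_univ_succ, w, partnerF, xLam, axisPair]
    field_simp
  · simp [Fin.sum_univ_succ, w, partnerF, xLam, axisPair]
    field_simp

/-! ## §5 `Λ_μ` is BOUNDED on the real momenta -/

/-- `|f_k(p)|² = 2 − 2cos p_k` at a real momentum. [cite: FederbushWilliamson1987PhaseCellII, (1.2) p. 1416] -/
theorem norm_sq_f_toC (p : Fin 4 → ℝ) (k : Fin 4) : ‖f (toC p) k‖ ^ 2 = 2 - 2 * Real.cos (p k) := by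
  have h := cexp_sub_one_mul_cexp_sub_one (p k)
  have h3 : (starRingEnd ℂ) (f (toC p) k) = cexp (I * p k) - 1 := by
    have := star_f_toC p k; rw [fbar, toC_apply] at this; exact this
  have h4 : ((Complex.normSq (f (toC p) k) : ℝ) : ℂ) = ((2 - 2 * Real.cos (p k) : ℝ) : ℂ) := by
    rw [← Complex.mul_conj, h3, show f (toC p) k = cexp (-I * p k) - 1 from rfl, h]
  rw [← Complex.normSq_eq_norm_sq, Complex.ofReal_injective h4]

/-- `|f̄_k(p)| = |f_k(p)|` at a real momentum. [cite: FederbushWilliamson1987PhaseCellII, (1.2), (1.5) p. 1416] -/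
theorem norm_fbar_toC (p : Fin 4 → ℝ) (k : Fin 4) : ‖fbar (toC p) k‖ = ‖f (toC p) k‖ := by
  rw [← star_f_toC]; exact norm_star _

/-- Jordan: `2 − 2cos q ≥ (4/π²) q²` for `|q| ≤ π`. [folklore] -/
private theorem two_sub_two_cos_ge {q : ℝ} (hq : |q| ≤ Real.pi) : 4 / Real.pi ^ 2 * q ^ 2 ≤ 2 - 2 * Real.cos q := by
  have hπ := Real.pi_pos
  -- reduce to `q ≥ 0` by evenness
  wlog hq0 : 0 ≤ q generalizing q
  · have h := this (q := -q) (by rwa [abs_neg]) (by linarith [le_of_not_ge hq0])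
    simpa [Real.cos_neg] using h
  have hq' : q ≤ Real.pi := (abs_of_nonneg hq0) ▸ hq
  have hs : 2 / Real.pi * (q / 2) ≤ Real.sin (q / 2) := Real.mul_le_sin (by linarith) (by linarith)
  have hs0 : 0 ≤ 2 / Real.pi * (q / 2) := by positivity
  have hcos : Real.cos q = 1 - 2 * Real.sin (q / 2) ^ 2 := by
    have h := Real.cos_sq (q / 2)
    rw [show 2 * (q / 2) = q by ring] at h
    have h1 := Real.sin_sq_add_cos_sq (q / 2)
    linarith
  have h2 : (2 / Real.pi * (q / 2)) ^ 2 ≤ Real.sin (q / 2) ^ 2 := pow_le_pow_left₀ hs0 hs 2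
  have h3 : (2 / Real.pi * (q / 2)) ^ 2 = (1 / 4) * (4 / Real.pi ^ 2 * q ^ 2) := by
    ring
  rw [h3] at h2
  rw [hcos]
  linarith

/-- The uniform constant `c₀ = (1/4π²)(4/π²)⁵`. [folklore] -/
def c0 : ℝ := 1 / (4 * Real.pi ^ 2) * (4 / Real.pi ^ 2) ^ 5

/-- [folklore] -/
private theorem c0_pos : 0 < c0 := by unfold c0; positivity

/-- **Uniform lower bound `⟨1/p_k²⟩·|f_k|² ≥ c₀ > 0`** at every real momentum off `2πℤ⁴`: keep the single lattice term nearest to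
`p` (the reduced momentum `q ∈ [−π, π]⁴`), where `(2 − 2cos q_i)/q_i² ≥ 4/π²` and `1/q² ≥ 1/(4π²)`.
[cite: FederbushWilliamson1987PhaseCellII, (1.4) p. 1416, (3.1)–(3.2) p. 1417] -/
theorem c0_le_invSqBracketR_mul {p : Fin 4 → ℝ} (hp : ∀ k (m : ℤ), p k ≠ 2 * Real.pi * m) (k : Fin 4) :
    c0 ≤ invSqBracketR k p * ‖f (toC p) k‖ ^ 2 := by
  set n0 : Fin 4 → ℤ := fun j => -cellIndex p j with hn0
  have hq : ∀ j, shiftR p n0 j = reduced p j := fun j => by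
    rw [shiftR_eq_reduced]; simp [hn0]
  have hqπ : ∀ j, |reduced p j| ≤ Real.pi := abs_reduced_le p
  have hq0 : ∀ j, reduced p j ≠ 0 := fun j h => by
    have := shiftR_ne_zero (hp j) n0; rw [hq j] at this; exact this h
  have hcos : ∀ j, 2 - 2 * Real.cos (p j) = 2 - 2 * Real.cos (reduced p j) := by
    intro j
    have : p j = reduced p j + (cellIndex p j : ℤ) * (2 * Real.pi) := by simp only [reduced]; ring
    rw [this, Real.cos_add_int_mul_two_pi]
  -- the single term
  have hterm : c0 / ‖f (toC p) k‖ ^ 2 ≤ invSqTermR k p n0 := by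
    have hfk : ‖f (toC p) k‖ ^ 2 = 2 - 2 * Real.cos (reduced p k) := by rw [norm_sq_f_toC, hcos]
    have hT : invSqTermR k p n0 = (1 / ∑ j, reduced p j ^ 2) *
        (∏ j, (2 - 2 * Real.cos (reduced p j)) / reduced p j ^ 2) * (1 / reduced p k ^ 2) := by
      unfold invSqTermR; simp_rw [hq, hcos]
    have hck : 0 < 2 - 2 * Real.cos (reduced p k) := by
      have h := two_sub_two_cos_ge (hqπ k)
      have : 0 < 4 / Real.pi ^ 2 * reduced p k ^ 2 := by have := hq0 k; positivity
      linarith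
    have h1 : 1 / (4 * Real.pi ^ 2) ≤ 1 / ∑ j, reduced p j ^ 2 := by
      have hs : ∑ j, reduced p j ^ 2 ≤ 4 * Real.pi ^ 2 := by
        calc ∑ j, reduced p j ^ 2 ≤ ∑ _j : Fin 4, Real.pi ^ 2 :=
              Finset.sum_le_sum fun j _ => by
                have := hqπ j; rw [← sq_abs]; exact pow_le_pow_left₀ (abs_nonneg _) this 2
          _ = 4 * Real.pi ^ 2 := by simp
      have hs0 : 0 < ∑ j, reduced p j ^ 2 :=
        lt_of_lt_of_le (by have := hq0 k; positivity) (Finset.single_le_sum (f := fun j => reduced p j ^ 2)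
          (fun j _ => sq_nonneg _) (Finset.mem_univ k))
      exact one_div_le_one_div_of_le hs0 hs
    have h2 : ∀ j, 4 / Real.pi ^ 2 ≤ (2 - 2 * Real.cos (reduced p j)) / reduced p j ^ 2 := fun j => by
      rw [le_div_iff₀ (by have := hq0 j; positivity)]
      exact two_sub_two_cos_ge (hqπ j)
    have h3 : (4 / Real.pi ^ 2) ^ 4 ≤ ∏ j, (2 - 2 * Real.cos (reduced p j)) / reduced p j ^ 2 := by
      calc (4 / Real.pi ^ 2) ^ 4 = ∏ _j : Fin 4, (4 / Real.pi ^ 2 : ℝ) := by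
            rw [Finset.prod_const, Finset.card_univ, Fintype.card_fin]
        _ ≤ _ := Finset.prod_le_prod (fun j _ => by positivity) fun j _ => h2 j
    have h4 : 4 / Real.pi ^ 2 / (2 - 2 * Real.cos (reduced p k)) ≤ 1 / reduced p k ^ 2 := by
      have hqk : 0 < reduced p k ^ 2 := by have := hq0 k; positivity
      calc 4 / Real.pi ^ 2 / (2 - 2 * Real.cos (reduced p k))
          ≤ 4 / Real.pi ^ 2 / (4 / Real.pi ^ 2 * reduced p k ^ 2) :=
            div_le_div_of_nonneg_left (by positivity) (by positivity) (two_sub_two_cos_ge (hqπ k))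
        _ = 1 / reduced p k ^ 2 := by field_simp
    have hsplit : c0 / ‖f (toC p) k‖ ^ 2
        = 1 / (4 * Real.pi ^ 2) * (4 / Real.pi ^ 2) ^ 4 * (4 / Real.pi ^ 2 / (2 - 2 * Real.cos (reduced p k))) := by
      rw [hfk]; unfold c0; ring
    rw [hsplit, hT]
    have hP : 0 ≤ ∏ j, (2 - 2 * Real.cos (reduced p j)) / reduced p j ^ 2 := le_trans (by positivity) h3
    refine mul_le_mul (mul_le_mul h1 h3 (by positivity) ?_) h4 (by positivity) (mul_nonneg ?_ hP)
    · exact le_trans (by positivity) h1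
    · exact le_trans (by positivity) h1
  have hle : invSqTermR k p n0 ≤ invSqBracketR k p := by
    unfold invSqBracketR
    have := (summable_invSqTermR hp k).sum_le_tsum {n0} (fun n _ => invSqTermR_nonneg k p n)
    simpa using this
  have hfpos : 0 < ‖f (toC p) k‖ ^ 2 := by
    have := f_toC_ne_zero (hp k); positivity
  rw [div_le_iff₀ hfpos] at hterm
  exact hterm.trans (mul_le_mul_of_nonneg_right hle hfpos.le)

/-- The real values: `l_μ`, `𝒟` at a real momentum in terms of the positive reals `⟨1/p_j²⟩`. [cite: FederbushWilliamson1987PhaseCellII, (1.17)–(1.18), (2.2)–(2.3) p. 1417] -/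
theorem scrD_toC_re (p : Fin 4 → ℝ) :
    scrD (toC p) = ((16 * (invSqBracketR 1 p * invSqBracketR 2 p * invSqBracketR 3 p
      + invSqBracketR 0 p * invSqBracketR 2 p * invSqBracketR 3 p
      + invSqBracketR 0 p * invSqBracketR 1 p * invSqBracketR 3 p
      + invSqBracketR 0 p * invSqBracketR 1 p * invSqBracketR 2 p) : ℝ) : ℂ) := by
  have e0 : (Finset.univ : Finset (Fin 4)).erase 0 = {1, 2, 3} := by decide
  have e1 : (Finset.univ : Finset (Fin 4)).erase 1 = {0, 2, 3} := by decide
  have e2 : (Finset.univ : Finset (Fin 4)).erase 2 = {0, 1, 3} := by decide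
  have e3 : (Finset.univ : Finset (Fin 4)).erase 3 = {0, 1, 2} := by decide
  simp only [scrD, invSqBracket_toC_eq, Fin.sum_univ_four, e0, e1, e2, e3]
  simp [Finset.prod_insert, Finset.prod_singleton]
  ring

/-- **`Λ_μ` IS BOUNDED on the real momenta**: `|Λ_μ(p)| ≤ (1/2π)²/c₀` at every real `p` with no component in `2πℤ` (hence
a.e.; `Λ` is periodic).  Proof: dropping positive terms of `𝒟 = 16Σ_kΠ_{j≠k}⟨1/p_j²⟩` gives `16|l_μ|/𝒟 ≤ min(1/⟨1/p₁²⟩,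
1/⟨1/p_μ²⟩)`, and `⟨1/p_k²⟩|f_k|² ≥ c₀`. [cite: FederbushWilliamson1987PhaseCellII, (2.1)–(2.3) p. 1417, (1.18) p. 1417] -/
theorem norm_Lam_toC_le {p : Fin 4 → ℝ} (hp : ∀ k (m : ℤ), p k ≠ 2 * Real.pi * m) (μ : Fin 4) :
    ‖Lam μ (toC p)‖ ≤ 1 / (2 * Real.pi) ^ 2 / c0 := by
  -- abbreviations for the four positive brackets
  set β : Fin 4 → ℝ := fun j => invSqBracketR j p with hβ
  have hβpos : ∀ j, 0 < β j := fun j => invSqBracketR_pos hp j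
  have hβC : ∀ j, invSqBracket j (toC p) = (β j : ℂ) := fun j => invSqBracket_toC_eq j p
  set D : ℝ := 16 * (β 1 * β 2 * β 3 + β 0 * β 2 * β 3 + β 0 * β 1 * β 3 + β 0 * β 1 * β 2) with hD
  have hDC : scrD (toC p) = (D : ℂ) := by rw [scrD_toC_re p]
  have hb0 := hβpos 0; have hb1 := hβpos 1; have hb2 := hβpos 2; have hb3 := hβpos 3
  have hDpos : 0 < D := by rw [hD]; positivity
  -- the real value of `l_μ` and the key ratio bounds `16|l_μ|β_0 ≤ D`, `16|l_μ|β_μ ≤ D`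
  have t123 : 0 < β 1 * β 2 * β 3 := mul_pos (mul_pos (hβpos 1) (hβpos 2)) (hβpos 3)
  have t023 : 0 < β 0 * β 2 * β 3 := mul_pos (mul_pos (hβpos 0) (hβpos 2)) (hβpos 3)
  have t013 : 0 < β 0 * β 1 * β 3 := mul_pos (mul_pos (hβpos 0) (hβpos 1)) (hβpos 3)
  have t012 : 0 < β 0 * β 1 * β 2 := mul_pos (mul_pos (hβpos 0) (hβpos 1)) (hβpos 2)
  have p12 : 0 ≤ β 1 * β 2 := (mul_pos (hβpos 1) (hβpos 2)).le
  have p13 : 0 ≤ β 1 * β 3 := (mul_pos (hβpos 1) (hβpos 3)).le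
  have p23 : 0 ≤ β 2 * β 3 := (mul_pos (hβpos 2) (hβpos 3)).le
  have hl : ∃ L : ℝ, l μ (toC p) = (L : ℂ) ∧ 16 * |L| * β 0 ≤ D ∧ 16 * |L| * β μ ≤ D := by
    rcases fin4_cases μ with rfl | rfl | rfl | rfl
    · refine ⟨β 1 * β 2 + β 1 * β 3 + β 2 * β 3, ?_, ?_, ?_⟩
      · rw [ModeAnalyticityBracketSplit.l_zero]; simp only [hβC]; push_cast; ring
      · rw [abs_of_nonneg (by positivity), hD]; nlinarith
      · rw [abs_of_nonneg (by positivity), hD]; nlinarith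
    · refine ⟨-(β 2 * β 3), ?_, ?_, ?_⟩
      · rw [ModeAnalyticityGaugeRepair.l_one]; simp only [hβC]; push_cast; ring
      · rw [abs_neg, abs_of_nonneg p23, hD]; nlinarith
      · rw [abs_neg, abs_of_nonneg p23, hD]; nlinarith
    · refine ⟨-(β 1 * β 3), ?_, ?_, ?_⟩
      · rw [ModeAnalyticityGaugeRepair.l_two]; simp only [hβC]; push_cast; ring
      · rw [abs_neg, abs_of_nonneg p13, hD]; nlinarith
      · rw [abs_neg, abs_of_nonneg p13, hD]; nlinarith
    · refine ⟨-(β 1 * β 2), ?_, ?_, ?_⟩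
      · rw [ModeAnalyticityGaugeRepair.l_three]; simp only [hβC]; push_cast; ring
      · rw [abs_neg, abs_of_nonneg p12, hD]; nlinarith
      · rw [abs_neg, abs_of_nonneg p12, hD]; nlinarith
  obtain ⟨L, hL, hL0, hLμ⟩ := hl
  -- norms of the factors
  have hf0 : 0 < ‖f (toC p) 0‖ := norm_pos_iff.mpr (f_toC_ne_zero (hp 0))
  have hfμ : 0 < ‖f (toC p) μ‖ := norm_pos_iff.mpr (f_toC_ne_zero (hp μ))
  have hc0 := c0_le_invSqBracketR_mul hp 0
  have hcμ := c0_le_invSqBracketR_mul hp μ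
  have hπ2 : 0 < (2 * Real.pi) ^ 2 := by positivity
  -- the norm of Λ_μ
  have hnorm : ‖Lam μ (toC p)‖ = 1 / (2 * Real.pi) ^ 2 * (‖f (toC p) 0‖⁻¹ * ‖f (toC p) μ‖⁻¹ * (16 * |L| / D)) := by
    have e1 : (1 / (2 * (Real.pi : ℂ)) ^ 2 : ℂ) = ((1 / (2 * Real.pi) ^ 2 : ℝ) : ℂ) := by push_cast; ring
    have e2 : (16 : ℂ) / scrD (toC p) = ((16 / D : ℝ) : ℂ) := by rw [hDC]; push_cast; ring
    have n1 : ‖((1 / (2 * Real.pi) ^ 2 : ℝ) : ℂ)‖ = 1 / (2 * Real.pi) ^ 2 := by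
      rw [Complex.norm_real, Real.norm_of_nonneg (by positivity)]
    have n2 : ‖((16 / D : ℝ) : ℂ)‖ = 16 / D := by
      rw [Complex.norm_real, Real.norm_of_nonneg (by positivity)]
    have n3 : ‖(L : ℂ)‖ = |L| := by rw [Complex.norm_real, Real.norm_eq_abs]
    unfold Lam
    rw [e1, e2, hL, norm_mul, norm_mul, norm_mul, norm_mul, norm_inv, norm_inv, n1, n2, n3, norm_fbar_toC]
    ring
  rw [hnorm, div_eq_mul_one_div (1 / (2 * Real.pi) ^ 2) c0]
  refine mul_le_mul_of_nonneg_left ?_ (by positivity)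
  -- `‖f_0‖⁻¹‖f_μ‖⁻¹(16|L|/D) ≤ 1/c₀`, by cases on which of `‖f_0‖`, `‖f_μ‖` is smaller
  rw [le_div_iff₀ c0_pos]
  rcases le_total ‖f (toC p) 0‖ ‖f (toC p) μ‖ with h | h
  · -- use 16|L| ≤ D/β_0 and β_0 ‖f_0‖² ≥ c₀
    have h1 : 16 * |L| / D ≤ 1 / β 0 := by
      rw [div_le_div_iff₀ hDpos (hβpos 0)]; linarith
    calc ‖f (toC p) 0‖⁻¹ * ‖f (toC p) μ‖⁻¹ * (16 * |L| / D) * c0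
        ≤ ‖f (toC p) 0‖⁻¹ * ‖f (toC p) 0‖⁻¹ * (1 / β 0) * (β 0 * ‖f (toC p) 0‖ ^ 2) := by
          apply mul_le_mul _ hc0 c0_pos.le (by positivity)
          apply mul_le_mul _ h1 (by positivity) (by positivity)
          exact mul_le_mul_of_nonneg_left (inv_anti₀ hf0 h) (by positivity)
      _ = 1 := by field_simp
  · have hbμ := hβpos μ
    have h1 : 16 * |L| / D ≤ 1 / β μ := by
      rw [div_le_div_iff₀ hDpos (hβpos μ)]; linarith
    calc ‖f (toC p) 0‖⁻¹ * ‖f (toC p) μ‖⁻¹ * (16 * |L| / D) * c0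
        ≤ ‖f (toC p) μ‖⁻¹ * ‖f (toC p) μ‖⁻¹ * (1 / β μ) * (β μ * ‖f (toC p) μ‖ ^ 2) := by
          apply mul_le_mul _ hcμ c0_pos.le (by positivity)
          apply mul_le_mul _ h1 (by positivity) (by positivity)
          exact mul_le_mul_of_nonneg_right (inv_anti₀ hfμ h) (by positivity)
      _ = 1 := by field_simp [hbμ.ne', hfμ.ne']

end PlaquetteGram

end

end Literature.MathematicalPhysics.QuantumFieldTheory.Federbush1986
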